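import Summits.ResolutionOfSingularities.KangarooAtlas.MizutaniLinearChange
import Mathlib.Data.Nat.Multiplicity
import HarnessLib

/-!
# Mizutani's conjecture `m(e) = 2p^e − 1` — the polynomial tower model, VII: the profile under a linear change

Cell topic `Summits/ResolutionOfSingularities/KangarooAtlas` (pub-rosobs); namespace
`Summit.ResolutionOfSingularities.KangarooAtlas.Mizutani`.  Continuation of `MizutaniLinearChange`
(MIZUTANI-PROOF-g59 §1.4 INVARIANCES for the linear changes of §5).  In-house chain, AI-written; not
a resolution theorem.

* Kummer / Lucas (`dvd_choose_of_pow_le_add`): for `a, b < q = p^k ≤ a + b`, `p ∣ C(a+b, b)`;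
  hence (`natCast_mchoose_eq_zero`) the binomials `C(M + T₂, T₂)` of the coefficient formula
  vanish in `F` as soon as `M + T₂` leaves the box — so the HS matrix only reads box
  coefficients (`hsMatrix_congr_inBox`: the truncation `t^q = 0` of Oda's ring is automatic; this is
  the `L`-linearity of the `D^{(T)}`, `T ∈ Box`, MIZUTANI-PROOF-g59 §1.4).
* `hsMatrix_linChange` — for `ω` supported in the box, `HS(A·ω) = Γ(A) · φ_A(HS(ω)) · Λ(A)` with
  the square matrices of structure constants `Γ(A)[T,T'] = c_{T',T}(A)`, `Λ(A)[M',M] = c_{M',M}(A)`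
  (rows outside the box or of the wrong degree drop out by part VI).
* **`profile_linChange_le`** — `σ_n(A·ω) ≤ σ_n(ω)` for EVERY matrix `A` (no invertibility needed:
  rank of a product, and an entrywise ring-map image cannot raise the rank over the fraction
  fields).  This is the direction the chain uses: a lower bound proved for `A·ω` transfers to `ω`.

References: [Mizutani1973HironakaGroupSchemes] (Remark 2.10); [Oda1983HironakaGroupSchemeII]
(§1 p. 1166); [EGAIV4] Thm. 16.11.2.
-/

open MvPolynomial Literature.AlgebraicGeometry.Resolution

namespace Summit.ResolutionOfSingularities.KangarooAtlas.Mizutani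

/-! ## Kummer: binomials across the box boundary vanish mod `p` -/

section Kummer

/-- **Kummer's carry**: if `a, b < p^k ≤ a + b` then `p ∣ C(a + b, b)` (adding `a` and `b` in base `p`
carries out of position `k − 1`). [folklore] -/
theorem dvd_choose_of_pow_le_add {p k a b : ℕ} (hp : p.Prime) (ha : a < p ^ k) (hb : b < p ^ k)
    (hab : p ^ k ≤ a + b) : p ∣ (a + b).choose b := by
  have hk : 1 ≤ k := by
    rcases Nat.eq_zero_or_pos k with h | h
    · subst h; simp at ha hb hab; omega
    · exact h
  have hmult := hp.emultiplicity_choose' (n := a) (k := b) (b := a + b + 1)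
    (lt_of_le_of_lt (Nat.log_le_self _ _) (Nat.lt_succ_self _))
  have hmem : k ∈ (Finset.Ico 1 (a + b + 1)).filter fun i => p ^ i ≤ b % p ^ i + a % p ^ i := by
    rw [Finset.mem_filter, Finset.mem_Ico, Nat.mod_eq_of_lt hb, Nat.mod_eq_of_lt ha]
    refine ⟨⟨hk, ?_⟩, by omega⟩
    have := Nat.lt_pow_self hp.one_lt (n := k)
    omega
  have hcard : (1 : ℕ∞) ≤ emultiplicity p ((a + b).choose b) := by
    rw [hmult]
    exact_mod_cast Finset.card_pos.mpr ⟨k, hmem⟩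
  have := pow_dvd_of_le_emultiplicity hcard
  rwa [pow_one] at this

variable {ι F : Type*} [CommRing F] (p : ℕ) [Fact p.Prime] [CharP F p]

/-- The multi-binomial `C(M + T₂, T₂)` vanishes in characteristic `p` when `M, T₂` are in the box
`[0, p^k − 1]^ι` but `M + T₂` is not (MIZUTANI-PROOF-g59 §1.4: `D^{(T)}`, `T ∈ Box`, is
`L`-linear, i.e. kills `t^q`). [cite: Mizutani1973HironakaGroupSchemes, Remark 2.10 (in-house proof, §1.4 HS operators, Lucas)] -/
theorem natCast_mchoose_eq_zero (k : ℕ) {M T₂ : ι →₀ ℕ} (hM : InBox (p ^ k) M)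
    (hT₂ : InBox (p ^ k) T₂) (h : ¬ InBox (p ^ k) (M + T₂)) :
    ((mchoose (M + T₂) T₂ : ℕ) : F) = 0 := by
  obtain ⟨i, hi⟩ : ∃ i, p ^ k ≤ M i + T₂ i := by
    by_contra hc
    push Not at hc
    exact h fun i => by rw [Finsupp.add_apply]; exact hc i
  have hTi : T₂ i ≠ 0 := by
    intro h0
    have := hM i
    omega
  rw [mchoose, Nat.cast_prod]
  refine Finset.prod_eq_zero (Finsupp.mem_support_iff.mpr hTi) ?_
  rw [Finsupp.add_apply, CharP.cast_eq_zero_iff F p]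
  exact dvd_choose_of_pow_le_add (Fact.out) (hM i) (hT₂ i) hi

end Kummer

/-! ## The HS matrix reads only box coefficients -/

section BoxOnly

variable {ι κ F : Type*} [Field F] [Fintype ι] [DecidableEq ι] [DecidableEq κ] (e : ι → κ)
variable (p : ℕ) [Fact p.Prime] [CharP F p]

/-- **Truncation is automatic**: in characteristic `p` with `q = p^k`, the HS matrix of `ξ` depends
only on the coefficients of `ξ` in the box (MIZUTANI-PROOF-g59 §1.2/§1.4: `R = k[t]/(t^q)`; our
model never reads exponents outside the box). [cite: Mizutani1973HironakaGroupSchemes, Remark 2.10 (in-house proof, §1.4)] -/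
theorem hsMatrix_congr_inBox (he : Function.Injective e) (k n : ℕ) (ξ ξ' : Rel ι κ F)
    (h : ∀ M, InBox (p ^ k) M → coeff M ξ = coeff M ξ') :
    hsMatrix e (p ^ k) n ξ = hsMatrix e (p ^ k) n ξ' := by
  refine Matrix.ext fun T M => ?_
  rw [hsMatrix_apply, hsMatrix_apply, coeff_hsOp e he, coeff_hsOp e he]
  apply Finset.sum_congr rfl
  intro x hx
  have hx2 : InBox (p ^ k) x.2 := fun i => by
    have hle : x.2 i ≤ T.1.toF i := by
      have := congrArg (fun f : ι →₀ ℕ => f i) (Finset.mem_antidiagonal.mp hx)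
      simp only [Finsupp.add_apply] at this
      omega
    exact lt_of_le_of_lt hle (T.1.inBox_toF i)
  by_cases hb : InBox (p ^ k) (M.toF + x.2)
  · rw [h _ hb]
  · rw [natCast_mchoose_eq_zero p k M.inBox_toF hx2 hb, zero_mul, zero_mul]

omit [DecidableEq ι] in
/-- `(D^{(T)}⊗1)` keeps `t`-supports inside the box. [cite: EGAIV4, Thm. 16.11.2] -/
theorem inBox_of_mem_support_hsOp [DecidableEq ι] (he : Function.Injective e) (q : ℕ)
    {ω : Rel ι κ F} (hω : ∀ M ∈ ω.support, InBox q M) (T : ι →₀ ℕ) :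
    ∀ M ∈ (hsOp e T ω).support, InBox q M := by
  intro M hM
  rw [mem_support_iff, coeff_hsOp e he] at hM
  obtain ⟨x, -, hx⟩ := Finset.exists_ne_zero_of_sum_ne_zero hM
  have hc : coeff (M + x.2) ω ≠ 0 := by
    intro h0
    apply hx
    rw [h0, map_zero, mul_zero]
  have hb := hω _ (mem_support_iff.mpr hc)
  exact fun i => lt_of_le_of_lt (by rw [Finsupp.add_apply]; exact Nat.le_add_right _ _) (hb i)

end BoxOnly

/-! ## Re-indexing support sums by box indices -/

section Reindex

/-- A sum over a finset agrees with the sum over a finite type mapped injectively into the ambient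
type when the summand vanishes off the image and off the finset. [folklore] -/
theorem sum_eq_sum_fintype_of_vanishing {α β X : Type*} [Fintype α] [DecidableEq β]
    [AddCommMonoid X] (φ : α → β) (hφ : Function.Injective φ) (s : Finset β) (g : β → X)
    (h1 : ∀ b ∈ s, b ∉ Set.range φ → g b = 0) (h2 : ∀ a, φ a ∉ s → g (φ a) = 0) :
    ∑ b ∈ s, g b = ∑ a, g (φ a) := by
  classical
  have himage : ∑ a, g (φ a) = ∑ b ∈ Finset.univ.image φ, g b := by
    rw [Finset.sum_image fun a _ b _ h => hφ h]
  rw [himage]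
  have hs : ∑ b ∈ s, g b = ∑ b ∈ s ∪ Finset.univ.image φ, g b :=
    Finset.sum_subset Finset.subset_union_left fun b hb hbs => by
      rcases Finset.mem_union.mp hb with h | h
      · exact absurd h hbs
      · obtain ⟨a, -, rfl⟩ := Finset.mem_image.mp h
        exact h2 a hbs
  have hi : ∑ b ∈ Finset.univ.image φ, g b = ∑ b ∈ s ∪ Finset.univ.image φ, g b :=
    Finset.sum_subset Finset.subset_union_right fun b hb hbi => by
      rcases Finset.mem_union.mp hb with h | h
      · exact h1 b h fun ⟨a, ha⟩ => hbi (Finset.mem_image.mpr ⟨a, Finset.mem_univ _, ha⟩)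
      · exact absurd h hbi
  rw [hs, hi]

end Reindex

/-! ## `HS(A·ω) = Γ(A) · φ_A(HS(ω)) · Λ(A)` and `σ_n(A·ω) ≤ σ_n(ω)` -/

section Rank

variable {ι F : Type*} [Field F] [Fintype ι] [DecidableEq ι] (p : ℕ) [Fact p.Prime] [CharP F p]

/-- The row matrix of structure constants `Γ(A)[T, T'] = c_{T',T}(A)` (box rows of degree `≤ n`).
[cite: Mizutani1973HironakaGroupSchemes, Remark 2.10 (in-house proof, §1.4 (P3))] -/
noncomputable def lcRows (A : ι → ι → F) (q n : ℕ) :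
    Matrix {T : Box ι q // T.deg ≤ n} {T : Box ι q // T.deg ≤ n} (MvPolynomial ι F) :=
  fun T T' => C (lcCoeff A T'.1.toF T.1.toF)

/-- The column matrix of structure constants `Λ(A)[M', M] = c_{M',M}(A)` (box columns).
[cite: Mizutani1973HironakaGroupSchemes, Remark 2.10 (in-house proof, §5 expansion of (At)^M)] -/
noncomputable def lcCols (A : ι → ι → F) (q : ℕ) : Matrix (Box ι q) (Box ι q) (MvPolynomial ι F) :=
  fun M' M => C (lcCoeff A M'.toF M.toF)

/-- **The HS matrix after a linear change**: for `ω` supported in the box `[0, p^k − 1]^ι`,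
`HS(A·ω) = Γ(A) · φ_A(HS(ω)) · Λ(A)` (MIZUTANI-PROOF-g59 §1.4 (P3) made explicit in the model).
[cite: Mizutani1973HironakaGroupSchemes, Remark 2.10 (in-house proof, §1.4 INVARIANCES)] -/
theorem hsMatrix_linChange (A : ι → ι → F) (k n : ℕ) (ω : Rel ι ι F)
    (hω : ∀ M ∈ ω.support, InBox (p ^ k) M) :
    hsMatrix id (p ^ k) n (linChange A ω) =
      lcRows A (p ^ k) n * (hsMatrix id (p ^ k) n ω).map (lsubst F A) * lcCols A (p ^ k) := by
  have hid : Function.Injective (id : ι → ι) := Function.injective_id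
  refine Matrix.ext fun T M => ?_
  rw [hsMatrix_apply, hsOp_linChange, coeff_sum]
  -- outer sum: re-index by box rows of degree ≤ n
  have houter : ∑ T' ∈ (dtaylor id ω).support,
      coeff M.toF (C (C (lcCoeff A T' T.1.toF)) * linChange A (hsOp id T' ω)) =
      ∑ R : {T : Box ι (p ^ k) // T.deg ≤ n},
        coeff M.toF (C (C (lcCoeff A R.1.toF T.1.toF)) * linChange A (hsOp id R.1.toF ω)) := by
    refine sum_eq_sum_fintype_of_vanishing (fun R : {T : Box ι (p ^ k) // T.deg ≤ n} => R.1.toF)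
      (fun R R' h => Subtype.ext (Box.toF_injective h)) _ _ (fun T' _ hT' => ?_) (fun R hR => ?_)
    · -- `T'` off the image: outside the box, or of degree `≠ |T|`
      have hc : lcCoeff A T' T.1.toF = 0 := by
        by_cases hb : InBox (p ^ k) T'
        · by_contra hne
          apply hT'
          have hdeg := degree_eq_of_lcCoeff_ne_zero A hne
          have hle : (Box.ofF T' hb).deg ≤ n := by
            rw [← Box.degree_toF, Box.toF_ofF, ← hdeg, Box.degree_toF]; exact T.2
          exact ⟨⟨Box.ofF T' hb, hle⟩, Box.toF_ofF T' hb⟩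
        · exact lcCoeff_eq_zero_of_not_inBox p k A T.1.inBox_toF hb
      rw [hc, map_zero, map_zero, zero_mul, coeff_zero]
    · rw [notMem_support_iff] at hR
      rw [hsOp_apply, hR, map_zero, mul_zero, coeff_zero]
  rw [houter]
  -- expand both sides
  simp only [coeff_C_mul, coeff_linChange, Matrix.mul_apply, lcRows, lcCols, Matrix.map_apply,
    Finset.sum_mul, Finset.mul_sum]
  rw [Finset.sum_comm]
  refine Finset.sum_congr rfl fun R _ => ?_
  -- inner sum: re-index by box columns
  rw [sum_eq_sum_fintype_of_vanishing (fun M' : Box ι (p ^ k) => M'.toF) Box.toF_injective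
    (hsOp id R.1.toF ω).support
    (fun M' => C (lcCoeff A R.1.toF T.1.toF) *
      (lsubst F A (coeff M' (hsOp id R.1.toF ω)) * C (lcCoeff A M' M.toF)))
    (fun M' hM' hrange => absurd ⟨Box.ofF M' (inBox_of_mem_support_hsOp id hid (p ^ k) hω _ M' hM'),
      Box.toF_ofF _ _⟩ hrange)
    (fun M' hM' => by rw [notMem_support_iff.mp hM', map_zero, zero_mul, mul_zero])]
  refine Finset.sum_congr rfl fun M' _ => ?_
  rw [hsMatrix_apply]
  ring

/-- Over domains, an entrywise ring-map image never has larger rank over the fraction fields.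
[folklore] -/
theorem rank_map_fractionRing_le_of_map {A A' : Type*} [CommRing A] [IsDomain A] [CommRing A']
    [IsDomain A'] (f : A →+* A') {m n : Type*} [Fintype m] [Fintype n] (H : Matrix m n A) :
    ((H.map f).map (algebraMap A' (FractionRing A'))).rank ≤
      (H.map (algebraMap A (FractionRing A))).rank := by
  by_contra hlt
  push Not at hlt
  obtain ⟨rows, cols, hne⟩ :=
    (Literature.LinearAlgebra.Matrix.le_rank_iff_exists_det_submatrix_ne_zero _).mp
      (Nat.succ_le_of_lt hlt)
  rw [det_submatrix_map_ne_zero_iff _ (IsFractionRing.injective _ _), Matrix.submatrix_map,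
    ← RingHom.mapMatrix_apply, ← RingHom.map_det] at hne
  have hne' : (H.submatrix rows cols).det ≠ 0 := fun h => hne (by rw [h, map_zero])
  have := (Literature.LinearAlgebra.Matrix.le_rank_iff_exists_det_submatrix_ne_zero _).mpr
    ⟨rows, cols, (det_submatrix_map_ne_zero_iff _
      (IsFractionRing.injective A (FractionRing A)) H rows cols).mpr hne'⟩
  omega

/-- **`σ_n(A·ω) ≤ σ_n(ω)` for every matrix `A`** (MIZUTANI-PROOF-g59 §1.4 INVARIANCES: for
`A ∈ GL_s` the profile is invariant; the chain only needs this inequality, and it holds for all `A`).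
[cite: Mizutani1973HironakaGroupSchemes, Remark 2.10 (in-house proof, §1.4 INVARIANCES / §5)] -/
theorem profile_linChange_le (A : ι → ι → F) (k n : ℕ) (ω : Rel ι ι F)
    (hω : ∀ M ∈ ω.support, InBox (p ^ k) M) :
    profile id (p ^ k) n (linChange A ω) ≤ profile id (p ^ k) n ω := by
  unfold profile
  rw [hsMatrix_linChange p A k n ω hω]
  simp only [Matrix.map_mul]
  refine le_trans (Matrix.rank_mul_le_left _ _) ?_
  refine le_trans (Matrix.rank_mul_le_right _ _) ?_
  exact rank_map_fractionRing_le_of_map (lsubst F A : MvPolynomial ι F →+* MvPolynomial ι F) _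

end Rank

end Summit.ResolutionOfSingularities.KangarooAtlas.Mizutani
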